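import Summits.QuantumFields.BalabanUV.Beta.FP.CoarseJetOrderTwoGradedCombJunctionRecordAn1

/-!
# `BalabanUV.Beta.FP.CoarseJetOrderTwoGradedCombJunctionRecordAn1Polar` — road «FP» (binder row D1), ROUTE T, junction J3 (leaf-05): **THE DOOR's `hId₂` POLYNOMIAL
# AT an1's RECORD, POLARISED** — the `(k,l)`-symmetrised bilinear twin of `torus_thetaWord_record_an1` (the OWNER's #40b `hHG₂` books the order-2 word along TWO
# directions `d k`, `d l`, symmetrised: `½ • (word(k,l) + word(l,k))`)

WHY.  `CoarseJetOrderTwoGradedCombJunctionRecordAn1.torus_thetaWord_record_an1` is QUADRATIC: jets along one coarse direction `v`.  The (T-ID) assembly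
(`LevelZeroLawFullIndex`, `hHG₂`) reads the door's order-2 word POLARISED: first jets along `d k` on the left and `d l` on the right of every monomial, second jets
along the pair `(d k, d l)`, then symmetrised in `k ↔ l`.  Since every monomial of the door's polynomial is exactly bilinear in the jets and the READ bindings are
(bi)linear in the direction, three instances of the quadratic identity (along `v`, `w`, `v + w`) give the symmetrised polarised identity by pure bookkeeping:
§1 `quadWord_add`, `respWord_add`; §2 the READ bindings along `v + w` split; §3 **`torus_thetaWord_record_an1_polar`**; §4 `Ws_swap ∕ Wz_swap` (an2's words are bond-pair
symmetric) and **`torus_thetaWord_record_an1_polar_sym`** (one set of second-order jets).  [folklore]; 0 def ∕ cite ∕ sorry.  Discharges NO row of the door, NO binder of row D1.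
HONEST DEPENDENCY (page 1, mandatory): continuum YM on T⁴ ⇐ BetaPertH ∧ nine spine estimates (0/9 proved); BetaPertH ⇐ (D1) ∧ (D4) ∧ CAP+tail;
G-an2-4 gates asym, D1 and NE2/3/4.  NOT the dictionary's `hId₂`, NOT (J-a), NOT (T-ID), NOT SDF, NOT D1, NEVER «G-an2-4 closed», NOT BetaPertH, NOT continuum,
NOT Clay; 0 estimates.  «not in print; our bookkeeping».  Unit `b2b-balaban-beta-d1-formalise-leaf-05` (gen 36), 2026-08-23; no existing file touched.
-/

noncomputable section

open scoped BigOperators Matrix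

namespace Summit.QuantumFields.BalabanUV.Beta.FP.CoarseJetOrderTwoGradedCombJunctionRecordAn1Polar

open Matrix
open Literature.MathematicalPhysics.QuantumFieldTheory.Balaban1983to89
open Literature.MathematicalPhysics.QuantumFieldTheory.Balaban1983to89.Beta
open B4TorusKernel.MultiPeriod (translate)
open ExpKernelCalculus (MKer)
open AffineAveraging (Site)
open OneStepResolventKernel (Fib)
open BalabanStepW2 (wV4 wB2 M2Of)
open SecondOrderResponse (dM K2OfK vertex2OfK mixOfK W2OfK W2SymOfK)
open Summit.QuantumFields.BalabanUV.Beta.SpineRooted (T2RecOf)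
open Summit.QuantumFields.BalabanUV.Beta.FP.KernelPeriodisationFib (Idx perF)
open Summit.QuantumFields.BalabanUV.Beta.FP.KernelPeriodisationFibLoc (dper)
open Summit.QuantumFields.BalabanUV.Beta.SymSecondOrderTablesAn1 (symTablesAn1S2)
open Summit.QuantumFields.BalabanUV.Beta.CombChartStepJets (GcombSh SpureCombOf)
open B6Lemma24Torus (pbox)
open AveragingContoursRooted (ctr)
open B5Prop11Plancherel (fine)
open Summit.QuantumFields.BalabanUV.Beta.AxialDressingRooted (axEc)
open Summit.QuantumFields.BalabanUV.Beta.FP.TorusGaugeCovarianceCoarse (coarsePt)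
open Summit.QuantumFields.BalabanUV.Beta.FP.CoarseJetOrderTwoGradedCombJunctionRecordAn1 (torus_thetaWord_record_an1)
/-! ## §1 Polarisation algebra of the door's polynomial and of the response sandwich -/
section Algebra

variable {ν μ : Type*} [Fintype ν] [Fintype μ]

/-- [folklore] **THE DOOR's ORDER-2 POLYNOMIAL ALONG `v + w` IS THE SUM OF THE FOUR POLARISED WORDS** (first jets READ as `Hk + Hl`, `Qk + Ql`; second jets as
`Hkk + Hkl + Hlk + Hll`, `Qkk + Qkl + Qlk + Qll`; the polarised word `word(k,l)` puts `k` on the left first-jet slot and `l` on the right one of every monomial —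
the OWNER's #40b placement, Θ-currency). -/
theorem quadWord_add (Θ : Matrix ν μ ℝ) (ΘL : Matrix μ ν ℝ) (Ŝ : Matrix μ μ ℝ) (Γc : Matrix ν ν ℝ)
    (Hk Hl Hkk Hkl Hlk Hll : Matrix ν ν ℝ) (Qk Ql Qkk Qkl Qlk Qll : Matrix μ ν ℝ) :
    (((-((-ΘL * (Hk + Hl) - Ŝ * (Qk + Ql)) * Γc - -ΘL * (Qk + Ql)ᵀ * -ΘL) * (Hk + Hl) + -ΘL * (Hkk + Hkl + Hlk + Hll)
          - (((-ΘL * (Hk + Hl) - Ŝ * (Qk + Ql)) * Θ + -ΘL * (Qk + Ql)ᵀ * Ŝ) * (Qk + Ql) + Ŝ * (Qkk + Qkl + Qlk + Qll))) * Θ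
        + (-ΘL * (Hk + Hl) - Ŝ * (Qk + Ql)) * (-((Γc * (Hk + Hl) + Θ * (Qk + Ql)) * Θ + Γc * (Qk + Ql)ᵀ * Ŝ)))
      - ((-((-ΘL * (Hk + Hl) - Ŝ * (Qk + Ql)) * Γc - -ΘL * (Qk + Ql)ᵀ * -ΘL) * (-(Qk + Ql)ᵀ) + -ΘL * (Qkk + Qkl + Qlk + Qll)ᵀ) * Ŝ
          + -ΘL * (-(Qk + Ql)ᵀ) * ((-ΘL * (Hk + Hl) - Ŝ * (Qk + Ql)) * Θ + -ΘL * (Qk + Ql)ᵀ * Ŝ)))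
      = ((((-((-ΘL * Hk - Ŝ * Qk) * Γc - -ΘL * Qkᵀ * -ΘL) * Hk + -ΘL * Hkk
          - (((-ΘL * Hk - Ŝ * Qk) * Θ + -ΘL * Qkᵀ * Ŝ) * Qk + Ŝ * Qkk)) * Θ
        + (-ΘL * Hk - Ŝ * Qk) * (-((Γc * Hk + Θ * Qk) * Θ + Γc * Qkᵀ * Ŝ)))
      - ((-((-ΘL * Hk - Ŝ * Qk) * Γc - -ΘL * Qkᵀ * -ΘL) * (-Qkᵀ) + -ΘL * Qkkᵀ) * Ŝ
          + -ΘL * (-Qkᵀ) * ((-ΘL * Hk - Ŝ * Qk) * Θ + -ΘL * Qkᵀ * Ŝ))))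
      + ((((-((-ΘL * Hk - Ŝ * Qk) * Γc - -ΘL * Qkᵀ * -ΘL) * Hl + -ΘL * Hkl
          - (((-ΘL * Hk - Ŝ * Qk) * Θ + -ΘL * Qkᵀ * Ŝ) * Ql + Ŝ * Qkl)) * Θ
        + (-ΘL * Hk - Ŝ * Qk) * (-((Γc * Hl + Θ * Ql) * Θ + Γc * Qlᵀ * Ŝ)))
      - ((-((-ΘL * Hk - Ŝ * Qk) * Γc - -ΘL * Qkᵀ * -ΘL) * (-Qlᵀ) + -ΘL * Qklᵀ) * Ŝ
          + -ΘL * (-Qkᵀ) * ((-ΘL * Hl - Ŝ * Ql) * Θ + -ΘL * Qlᵀ * Ŝ))))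
      + ((((-((-ΘL * Hl - Ŝ * Ql) * Γc - -ΘL * Qlᵀ * -ΘL) * Hk + -ΘL * Hlk
          - (((-ΘL * Hl - Ŝ * Ql) * Θ + -ΘL * Qlᵀ * Ŝ) * Qk + Ŝ * Qlk)) * Θ
        + (-ΘL * Hl - Ŝ * Ql) * (-((Γc * Hk + Θ * Qk) * Θ + Γc * Qkᵀ * Ŝ)))
      - ((-((-ΘL * Hl - Ŝ * Ql) * Γc - -ΘL * Qlᵀ * -ΘL) * (-Qkᵀ) + -ΘL * Qlkᵀ) * Ŝ
          + -ΘL * (-Qlᵀ) * ((-ΘL * Hk - Ŝ * Qk) * Θ + -ΘL * Qkᵀ * Ŝ))))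
      + ((((-((-ΘL * Hl - Ŝ * Ql) * Γc - -ΘL * Qlᵀ * -ΘL) * Hl + -ΘL * Hll
          - (((-ΘL * Hl - Ŝ * Ql) * Θ + -ΘL * Qlᵀ * Ŝ) * Ql + Ŝ * Qll)) * Θ
        + (-ΘL * Hl - Ŝ * Ql) * (-((Γc * Hl + Θ * Ql) * Θ + Γc * Qlᵀ * Ŝ)))
      - ((-((-ΘL * Hl - Ŝ * Ql) * Γc - -ΘL * Qlᵀ * -ΘL) * (-Qlᵀ) + -ΘL * Qllᵀ) * Ŝ
          + -ΘL * (-Qlᵀ) * ((-ΘL * Hl - Ŝ * Ql) * Θ + -ΘL * Qlᵀ * Ŝ)))) := by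
  simp only [Matrix.transpose_add, Matrix.mul_add, Matrix.add_mul, Matrix.mul_sub, Matrix.sub_mul, Matrix.neg_mul,
    Matrix.mul_neg, neg_add, neg_sub, neg_neg, Matrix.mul_assoc]
  abel

/-- [folklore] the response sandwich is additive in its two jets. -/
theorem respWord_add (Θ : Matrix ν μ ℝ) (ΘL : Matrix μ ν ℝ) (Ŝ : Matrix μ μ ℝ) (H₁ H₂ H₃ H₄ : Matrix ν ν ℝ) (Q₁ Q₂ Q₃ Q₄ : Matrix μ ν ℝ) :
    ΘL * (H₁ + H₂ + H₃ + H₄) * Θ + ΘL * (Q₁ + Q₂ + Q₃ + Q₄)ᵀ * Ŝ + Ŝ * (Q₁ + Q₂ + Q₃ + Q₄) * Θ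
      = (ΘL * H₁ * Θ + ΘL * Q₁ᵀ * Ŝ + Ŝ * Q₁ * Θ) + (ΘL * H₂ * Θ + ΘL * Q₂ᵀ * Ŝ + Ŝ * Q₂ * Θ)
        + (ΘL * H₃ * Θ + ΘL * Q₃ᵀ * Ŝ + Ŝ * Q₃ * Θ) + (ΘL * H₄ * Θ + ΘL * Q₄ᵀ * Ŝ + Ŝ * Q₄ * Θ) := by
  simp only [Matrix.transpose_add, Matrix.mul_add, Matrix.add_mul]
  abel

end Algebra
/-! ## §2 The READ bindings along `v + w` split -/
section Read

variable {ι α β γ : Type*} [Fintype γ]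

/-- [folklore] a first-order READ along `v + w` splits. -/
theorem submatrix_sum_smul_add (A : γ → Matrix ι ι ℝ) (v w : γ → ℝ) (f : α → ι) (g : β → ι) :
    (∑ b, (v + w) b • A b).submatrix f g = (∑ b, v b • A b).submatrix f g + (∑ b, w b • A b).submatrix f g := by
  ext i k
  simp only [Matrix.submatrix_apply, Matrix.add_apply, Matrix.sum_apply, Matrix.smul_apply, smul_eq_mul, Pi.add_apply, add_mul,
    Finset.sum_add_distrib]

/-- [folklore] a second-order READ along `(v + w) ⊗ (v + w)` splits into the four polarised READs. -/
theorem submatrix_sum_sum_smul_add (A : γ → γ → Matrix ι ι ℝ) (v w : γ → ℝ) (f : α → ι) (g : β → ι) :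
    (∑ b, ∑ b', ((v + w) b * (v + w) b') • A b b').submatrix f g
      = (∑ b, ∑ b', (v b * v b') • A b b').submatrix f g + (∑ b, ∑ b', (v b * w b') • A b b').submatrix f g
        + (∑ b, ∑ b', (w b * v b') • A b b').submatrix f g + (∑ b, ∑ b', (w b * w b') • A b b').submatrix f g := by
  ext i k
  simp only [Matrix.submatrix_apply, Matrix.add_apply, Matrix.sum_apply, Matrix.smul_apply, smul_eq_mul, Pi.add_apply, ← Finset.sum_add_distrib]
  refine Finset.sum_congr rfl fun b _ => Finset.sum_congr rfl fun b' _ => by ring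

/-- [folklore] the contracted right side along `(v + w) ⊗ (v + w)` splits into diagonal and polarised parts. -/
theorem sum_sum_add_mul_add (t : γ → γ → ℝ) (v w : γ → ℝ) :
    ∑ b, ∑ b', ((v + w) b * (v + w) b') * t b b'
      = ∑ b, ∑ b', (v b * v b') * t b b' + ∑ b, ∑ b', (v b * w b' + w b * v b') * t b b' + ∑ b, ∑ b', (w b * w b') * t b b' := by
  simp only [Pi.add_apply, ← Finset.sum_add_distrib]
  refine Finset.sum_congr rfl fun b _ => Finset.sum_congr rfl fun b' _ => by ring

end Read
/-! ## §3 The polarised identity at an1's record -/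
section Polar

variable {d : ℕ} {Lc : ℕ} [NeZero Lc] (M' : Fin (d + 1) → ℕ) [∀ μ, NeZero (M' μ)] (cΛ' cE cVH cΛ cE₂ cB : ℝ) (T : Fin 4 → Fin 4 → Fin 4 → Fin 4 → ℝ)

set_option synthInstance.maxSize 1024 in
set_option maxHeartbeats 800000 in
/-- **[folklore] `torus_thetaWord_record_an1_polar` — THE DOOR's `hId₂` AT an1's RECORD, POLARISED AND SYMMETRISED.**  Binders as in `torus_thetaWord_record_an1`
(door `Θ Θᴸ Ŝ Γ̂` VERBATIM; `hDh hWs hWz` an2's words), TWO directions `v w`, the jets READ along `v` (`H₁ Q₁₁`), along `w` (`H₁′ Q₁₁′`), along `(v,w)`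
(`H₂ Q₁₂ Hᶻ Qᶻ`) and along `(w,v)` (`H₂′ Q₁₂′ Hᶻ′ Qᶻ′`).  THEN for all coarse slots `a₁ a₂`, with `word(k,l)` the OWNER's polarised placement:
`(cE₂·wV4 (j+1)) · ((word(v,w) + word(w,v)) − (R(v,w) + R(w,v))) a₁ a₂ = Σ_{b̄ b̄′} (v_{b̄} w_{b̄′} + w_{b̄} v_{b̄′}) · perF M′ (dper M′ (T2_{j+1} b̄ b̄′ copy-summed)) (a₁.1, inl a₁.2) (a₂.1, inl a₂.2)`,
`R(v,w) := Θᴸ·Hᶻ·Θ + Θᴸ·Qᶻᵀ·Ŝ + Ŝ·Qᶻ·Θ` — three instances (`v`, `w`, `v + w`) of the quadratic theorem, §1, §2. -/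
theorem torus_thetaWord_record_an1_polar (j : ℕ)
    {Θ : Matrix (↥(pbox (fine Lc M')) × Fin (d + 1)) (↥(pbox M') × Fin (d + 1)) ℝ}
    {ΘL : Matrix (↥(pbox M') × Fin (d + 1)) (↥(pbox (fine Lc M')) × Fin (d + 1)) ℝ} {Ŝ : Matrix (↥(pbox M') × Fin (d + 1)) (↥(pbox M') × Fin (d + 1)) ℝ}
    {Γc : Matrix (↥(pbox (fine Lc M')) × Fin (d + 1)) (↥(pbox (fine Lc M')) × Fin (d + 1)) ℝ}
    (hΘ : Θ = Matrix.of fun (b : ↥(pbox (fine Lc M')) × Fin (d + 1)) (a : ↥(pbox M') × Fin (d + 1)) =>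
        axEc (ctr (d + 1) Lc) Lc (b.1 : Site (d + 1)) (b.1 : Site (d + 1)) (Sum.inl b.2) (Sum.inl b.2)
          * perF (fine Lc M') (GcombSh (d := d) Lc j) (b.1, Sum.inl b.2) (coarsePt M' Lc a.1, Sum.inr a.2))
    (hΘL : ΘL = Matrix.of fun (a : ↥(pbox M') × Fin (d + 1)) (b : ↥(pbox (fine Lc M')) × Fin (d + 1)) =>
        axEc (ctr (d + 1) Lc) Lc (b.1 : Site (d + 1)) (b.1 : Site (d + 1)) (Sum.inl b.2) (Sum.inl b.2)
          * perF (fine Lc M') (GcombSh (d := d) Lc j) (coarsePt M' Lc a.1, Sum.inr a.2) (b.1, Sum.inl b.2))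
    (hŜ : Ŝ = (perF (fine Lc M') (GcombSh (d := d) Lc j)).submatrix
        (fun a : ↥(pbox M') × Fin (d + 1) => ((coarsePt M' Lc a.1, Sum.inr a.2) : Idx (fine Lc M') (Fib d)))
        (fun a : ↥(pbox M') × Fin (d + 1) => ((coarsePt M' Lc a.1, Sum.inr a.2) : Idx (fine Lc M') (Fib d))))
    (hΓc : Γc = Matrix.of fun (b b' : ↥(pbox (fine Lc M')) × Fin (d + 1)) =>
        axEc (ctr (d + 1) Lc) Lc (b.1 : Site (d + 1)) (b.1 : Site (d + 1)) (Sum.inl b.2) (Sum.inl b.2)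
          * (axEc (ctr (d + 1) Lc) Lc (b'.1 : Site (d + 1)) (b'.1 : Site (d + 1)) (Sum.inl b'.2) (Sum.inl b'.2)
            * perF (fine Lc M') (GcombSh (d := d) Lc j) (b.1, Sum.inl b.2) (b'.1, Sum.inl b'.2)))
    {Dh : ↥(pbox M') × Fin (d + 1) → Matrix (Idx (fine Lc M') (Fib d)) (Idx (fine Lc M') (Fib d)) ℝ}
    (hDh : Dh = fun b => perF (fine Lc M') (dM (GcombSh (d := d) Lc j) Lc (fun κ u => dper (fine Lc M') (SpureCombOf (symTablesAn1S2 d Lc cΛ') cE cVH cΛ j κ u))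
        (fun ρ w => dper (fine Lc M') ((symTablesAn1S2 d Lc cΛ').M j ρ w)) b.2 (b.1 : Site (d + 1))))
    {Ws Wz : ↥(pbox M') × Fin (d + 1) → ↥(pbox M') × Fin (d + 1) → Matrix (Idx (fine Lc M') (Fib d)) (Idx (fine Lc M') (Fib d)) ℝ}
    (hWs : Ws = fun b b' => (1 / 2 : ℝ) •
        ((perF (fine Lc M') (vertex2OfK (GcombSh (d := d) Lc j) Lc (fun κ u κ' u' => dper (fine Lc M') (fun x z a c => ∑' n : Site (d + 1),
              T2RecOf d Lc (GcombSh Lc) (SpureCombOf (symTablesAn1S2 d Lc cΛ') cE cVH cΛ) (symTablesAn1S2 d Lc cΛ').M cE₂ cB T (symTablesAn1S2 d Lc cΛ').vh₂S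
                (symTablesAn1S2 d Lc cΛ').mixFF j κ u κ' (translate (fine Lc M') u' n) x z a c)) b.2 (b.1 : Site (d + 1)) b'.2 (b'.1 : Site (d + 1)))
            + perF (fine Lc M') (mixOfK (GcombSh (d := d) Lc j) Lc
                (fun κ u ρ w => dper (fine Lc M') (fun x z a c => ∑' n : Site (d + 1), M2Of d Lc (symTablesAn1S2 d Lc cΛ').mixFF j κ u ρ (translate M' w n) x z a c))
                b.2 (b.1 : Site (d + 1)) b'.2 (b'.1 : Site (d + 1)))
            + perF (fine Lc M') (mixOfK (GcombSh (d := d) Lc j) Lc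
                (fun κ u ρ w => dper (fine Lc M') (fun x z a c => ∑' n : Site (d + 1), M2Of d Lc (symTablesAn1S2 d Lc cΛ').mixFF j κ u ρ (translate M' w n) x z a c))
                b'.2 (b'.1 : Site (d + 1)) b.2 (b.1 : Site (d + 1))))
          + (perF (fine Lc M') (vertex2OfK (GcombSh (d := d) Lc j) Lc (fun κ u κ' u' => dper (fine Lc M') (fun x z a c => ∑' n : Site (d + 1),
              T2RecOf d Lc (GcombSh Lc) (SpureCombOf (symTablesAn1S2 d Lc cΛ') cE cVH cΛ) (symTablesAn1S2 d Lc cΛ').M cE₂ cB T (symTablesAn1S2 d Lc cΛ').vh₂S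
                (symTablesAn1S2 d Lc cΛ').mixFF j κ u κ' (translate (fine Lc M') u' n) x z a c)) b'.2 (b'.1 : Site (d + 1)) b.2 (b.1 : Site (d + 1)))
            + perF (fine Lc M') (mixOfK (GcombSh (d := d) Lc j) Lc
                (fun κ u ρ w => dper (fine Lc M') (fun x z a c => ∑' n : Site (d + 1), M2Of d Lc (symTablesAn1S2 d Lc cΛ').mixFF j κ u ρ (translate M' w n) x z a c))
                b'.2 (b'.1 : Site (d + 1)) b.2 (b.1 : Site (d + 1)))
            + perF (fine Lc M') (mixOfK (GcombSh (d := d) Lc j) Lc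
                (fun κ u ρ w => dper (fine Lc M') (fun x z a c => ∑' n : Site (d + 1), M2Of d Lc (symTablesAn1S2 d Lc cΛ').mixFF j κ u ρ (translate M' w n) x z a c))
                b.2 (b.1 : Site (d + 1)) b'.2 (b'.1 : Site (d + 1))))))
    (hWz : Wz = fun b b' => (1 / 2 : ℝ) •
        (perF (fine Lc M') (dM (K2OfK (GcombSh (d := d) Lc j) Lc (fun κ u => dper (fine Lc M') (SpureCombOf (symTablesAn1S2 d Lc cΛ') cE cVH cΛ j κ u))
              (fun ρ w => dper (fine Lc M') ((symTablesAn1S2 d Lc cΛ').M j ρ w)) b'.2 (b'.1 : Site (d + 1))) Lc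
            (fun κ u => dper (fine Lc M') (SpureCombOf (symTablesAn1S2 d Lc cΛ') cE cVH cΛ j κ u)) (fun ρ w => dper (fine Lc M') ((symTablesAn1S2 d Lc cΛ').M j ρ w))
            b.2 (b.1 : Site (d + 1)))
          + perF (fine Lc M') (dM (K2OfK (GcombSh (d := d) Lc j) Lc (fun κ u => dper (fine Lc M') (SpureCombOf (symTablesAn1S2 d Lc cΛ') cE cVH cΛ j κ u))
              (fun ρ w => dper (fine Lc M') ((symTablesAn1S2 d Lc cΛ').M j ρ w)) b.2 (b.1 : Site (d + 1))) Lc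
            (fun κ u => dper (fine Lc M') (SpureCombOf (symTablesAn1S2 d Lc cΛ') cE cVH cΛ j κ u)) (fun ρ w => dper (fine Lc M') ((symTablesAn1S2 d Lc cΛ').M j ρ w))
            b'.2 (b'.1 : Site (d + 1)))))
    -- two directions and the door's jets READ along `v`, `w`, `(v,w)`, `(w,v)`
    (v w : ↥(pbox M') × Fin (d + 1) → ℝ)
    {H₁ H₁' H₂ H₂' Hz Hz' : Matrix (↥(pbox (fine Lc M')) × Fin (d + 1)) (↥(pbox (fine Lc M')) × Fin (d + 1)) ℝ}
    {Q₁₁ Q₁₁' Q₁₂ Q₁₂' Qz Qz' : Matrix (↥(pbox M') × Fin (d + 1)) (↥(pbox (fine Lc M')) × Fin (d + 1)) ℝ}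
    (hH₁ : H₁ = (∑ b, v b • Dh b).submatrix (fun b : ↥(pbox (fine Lc M')) × Fin (d + 1) => ((b.1, Sum.inl b.2) : Idx (fine Lc M') (Fib d)))
        (fun b : ↥(pbox (fine Lc M')) × Fin (d + 1) => ((b.1, Sum.inl b.2) : Idx (fine Lc M') (Fib d))))
    (hQ₁₁ : Q₁₁ = (∑ b, v b • Dh b).submatrix (fun a : ↥(pbox M') × Fin (d + 1) => ((coarsePt M' Lc a.1, Sum.inr a.2) : Idx (fine Lc M') (Fib d)))
        (fun b : ↥(pbox (fine Lc M')) × Fin (d + 1) => ((b.1, Sum.inl b.2) : Idx (fine Lc M') (Fib d))))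
    (hH₂ : H₂ = (∑ b, ∑ b', (v b * w b') • Ws b b').submatrix (fun b : ↥(pbox (fine Lc M')) × Fin (d + 1) => ((b.1, Sum.inl b.2) : Idx (fine Lc M') (Fib d)))
        (fun b : ↥(pbox (fine Lc M')) × Fin (d + 1) => ((b.1, Sum.inl b.2) : Idx (fine Lc M') (Fib d))))
    (hQ₁₂ : Q₁₂ = (∑ b, ∑ b', (v b * w b') • Ws b b').submatrix (fun a : ↥(pbox M') × Fin (d + 1) => ((coarsePt M' Lc a.1, Sum.inr a.2) : Idx (fine Lc M') (Fib d)))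
        (fun b : ↥(pbox (fine Lc M')) × Fin (d + 1) => ((b.1, Sum.inl b.2) : Idx (fine Lc M') (Fib d))))
    (hHz : Hz = (∑ b, ∑ b', (v b * w b') • Wz b b').submatrix (fun b : ↥(pbox (fine Lc M')) × Fin (d + 1) => ((b.1, Sum.inl b.2) : Idx (fine Lc M') (Fib d)))
        (fun b : ↥(pbox (fine Lc M')) × Fin (d + 1) => ((b.1, Sum.inl b.2) : Idx (fine Lc M') (Fib d))))
    (hQz : Qz = (∑ b, ∑ b', (v b * w b') • Wz b b').submatrix (fun a : ↥(pbox M') × Fin (d + 1) => ((coarsePt M' Lc a.1, Sum.inr a.2) : Idx (fine Lc M') (Fib d)))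
        (fun b : ↥(pbox (fine Lc M')) × Fin (d + 1) => ((b.1, Sum.inl b.2) : Idx (fine Lc M') (Fib d))))
    (hH₁' : H₁' = (∑ b, w b • Dh b).submatrix (fun b : ↥(pbox (fine Lc M')) × Fin (d + 1) => ((b.1, Sum.inl b.2) : Idx (fine Lc M') (Fib d)))
        (fun b : ↥(pbox (fine Lc M')) × Fin (d + 1) => ((b.1, Sum.inl b.2) : Idx (fine Lc M') (Fib d))))
    (hQ₁₁' : Q₁₁' = (∑ b, w b • Dh b).submatrix (fun a : ↥(pbox M') × Fin (d + 1) => ((coarsePt M' Lc a.1, Sum.inr a.2) : Idx (fine Lc M') (Fib d)))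
        (fun b : ↥(pbox (fine Lc M')) × Fin (d + 1) => ((b.1, Sum.inl b.2) : Idx (fine Lc M') (Fib d))))
    (hH₂' : H₂' = (∑ b, ∑ b', (w b * v b') • Ws b b').submatrix (fun b : ↥(pbox (fine Lc M')) × Fin (d + 1) => ((b.1, Sum.inl b.2) : Idx (fine Lc M') (Fib d)))
        (fun b : ↥(pbox (fine Lc M')) × Fin (d + 1) => ((b.1, Sum.inl b.2) : Idx (fine Lc M') (Fib d))))
    (hQ₁₂' : Q₁₂' = (∑ b, ∑ b', (w b * v b') • Ws b b').submatrix (fun a : ↥(pbox M') × Fin (d + 1) => ((coarsePt M' Lc a.1, Sum.inr a.2) : Idx (fine Lc M') (Fib d)))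
        (fun b : ↥(pbox (fine Lc M')) × Fin (d + 1) => ((b.1, Sum.inl b.2) : Idx (fine Lc M') (Fib d))))
    (hHz' : Hz' = (∑ b, ∑ b', (w b * v b') • Wz b b').submatrix (fun b : ↥(pbox (fine Lc M')) × Fin (d + 1) => ((b.1, Sum.inl b.2) : Idx (fine Lc M') (Fib d)))
        (fun b : ↥(pbox (fine Lc M')) × Fin (d + 1) => ((b.1, Sum.inl b.2) : Idx (fine Lc M') (Fib d))))
    (hQz' : Qz' = (∑ b, ∑ b', (w b * v b') • Wz b b').submatrix (fun a : ↥(pbox M') × Fin (d + 1) => ((coarsePt M' Lc a.1, Sum.inr a.2) : Idx (fine Lc M') (Fib d)))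
        (fun b : ↥(pbox (fine Lc M')) × Fin (d + 1) => ((b.1, Sum.inl b.2) : Idx (fine Lc M') (Fib d))))
    (a₁ a₂ : ↥(pbox M') × Fin (d + 1)) :
    (cE₂ * wV4 d Lc (j + 1)) *
      ((((((-((-ΘL * H₁ - Ŝ * Q₁₁) * Γc - -ΘL * Q₁₁ᵀ * -ΘL) * H₁' + -ΘL * H₂
          - (((-ΘL * H₁ - Ŝ * Q₁₁) * Θ + -ΘL * Q₁₁ᵀ * Ŝ) * Q₁₁' + Ŝ * Q₁₂)) * Θ
        + (-ΘL * H₁ - Ŝ * Q₁₁) * (-((Γc * H₁' + Θ * Q₁₁') * Θ + Γc * Q₁₁'ᵀ * Ŝ)))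
      - ((-((-ΘL * H₁ - Ŝ * Q₁₁) * Γc - -ΘL * Q₁₁ᵀ * -ΘL) * (-Q₁₁'ᵀ) + -ΘL * Q₁₂ᵀ) * Ŝ
          + -ΘL * (-Q₁₁ᵀ) * ((-ΘL * H₁' - Ŝ * Q₁₁') * Θ + -ΘL * Q₁₁'ᵀ * Ŝ))))
        + ((((-((-ΘL * H₁' - Ŝ * Q₁₁') * Γc - -ΘL * Q₁₁'ᵀ * -ΘL) * H₁ + -ΘL * H₂'
          - (((-ΘL * H₁' - Ŝ * Q₁₁') * Θ + -ΘL * Q₁₁'ᵀ * Ŝ) * Q₁₁ + Ŝ * Q₁₂')) * Θ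
        + (-ΘL * H₁' - Ŝ * Q₁₁') * (-((Γc * H₁ + Θ * Q₁₁) * Θ + Γc * Q₁₁ᵀ * Ŝ)))
      - ((-((-ΘL * H₁' - Ŝ * Q₁₁') * Γc - -ΘL * Q₁₁'ᵀ * -ΘL) * (-Q₁₁ᵀ) + -ΘL * Q₁₂'ᵀ) * Ŝ
          + -ΘL * (-Q₁₁'ᵀ) * ((-ΘL * H₁ - Ŝ * Q₁₁) * Θ + -ΘL * Q₁₁ᵀ * Ŝ)))))
        - ((ΘL * Hz * Θ + ΘL * Qzᵀ * Ŝ + Ŝ * Qz * Θ) + (ΘL * Hz' * Θ + ΘL * Qz'ᵀ * Ŝ + Ŝ * Qz' * Θ))) a₁ a₂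
      = ∑ b : ↥(pbox M') × Fin (d + 1), ∑ b' : ↥(pbox M') × Fin (d + 1), (v b * w b' + w b * v b')
          * perF M' (dper M' (fun x z a c => ∑' n, T2RecOf d Lc (GcombSh Lc) (SpureCombOf (symTablesAn1S2 d Lc cΛ') cE cVH cΛ) (symTablesAn1S2 d Lc cΛ').M cE₂ cB T
              (symTablesAn1S2 d Lc cΛ').vh₂S (symTablesAn1S2 d Lc cΛ').mixFF (j + 1)
              b.2 (b.1 : Site (d + 1)) b'.2 (translate M' (b'.1 : Site (d + 1)) n) x z a c)) (a₁.1, Sum.inl a₁.2) (a₂.1, Sum.inl a₂.2) := by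
  subst hH₁ hQ₁₁ hH₂ hQ₁₂ hHz hQz hH₁' hQ₁₁' hH₂' hQ₁₂' hHz' hQz'
  -- three instances of the quadratic identity
  have Tvw := torus_thetaWord_record_an1 M' cΛ' cE cVH cΛ cE₂ cB T j hΘ hΘL hŜ hΓc hDh hWs hWz (v + w) rfl rfl rfl rfl rfl rfl a₁ a₂
  have Tv := torus_thetaWord_record_an1 M' cΛ' cE cVH cΛ cE₂ cB T j hΘ hΘL hŜ hΓc hDh hWs hWz v rfl rfl rfl rfl rfl rfl a₁ a₂
  have Tw := torus_thetaWord_record_an1 M' cΛ' cE cVH cΛ cE₂ cB T j hΘ hΘL hŜ hΓc hDh hWs hWz w rfl rfl rfl rfl rfl rfl a₁ a₂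
  -- the jets along `v + w` split; the polynomial and the sandwich polarise; the right side splits
  rw [submatrix_sum_smul_add, submatrix_sum_smul_add, submatrix_sum_sum_smul_add, submatrix_sum_sum_smul_add, submatrix_sum_sum_smul_add,
    submatrix_sum_sum_smul_add, quadWord_add, respWord_add, sum_sum_add_mul_add] at Tvw
  simp only [Matrix.add_apply, Matrix.sub_apply] at Tvw Tv Tw ⊢
  linear_combination Tvw - Tv - Tw

end Polar
/-! ## §4 At the record the second-order READs along `(v,w)` and `(w,v)` COINCIDE (an2's slot and response words are booked bond-pair symmetric) -/
section Swap

variable {d : ℕ} {Lc : ℕ} [NeZero Lc] (M' : Fin (d + 1) → ℕ) [∀ μ, NeZero (M' μ)] (cΛ' cE cVH cΛ cE₂ cB : ℝ) (T : Fin 4 → Fin 4 → Fin 4 → Fin 4 → ℝ)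

omit [∀ μ, NeZero (M' μ)] in
/-- [folklore] the slot word is symmetric in the bond pair (it is booked as `½ • (A(b̄,b̄′) + A(b̄′,b̄))`). -/
theorem Ws_swap (j : ℕ) {Ws : ↥(pbox M') × Fin (d + 1) → ↥(pbox M') × Fin (d + 1) → Matrix (Idx (fine Lc M') (Fib d)) (Idx (fine Lc M') (Fib d)) ℝ}
    (hWs : Ws = fun b b' => (1 / 2 : ℝ) •
        ((perF (fine Lc M') (vertex2OfK (GcombSh (d := d) Lc j) Lc (fun κ u κ' u' => dper (fine Lc M') (fun x z a c => ∑' n : Site (d + 1),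
              T2RecOf d Lc (GcombSh Lc) (SpureCombOf (symTablesAn1S2 d Lc cΛ') cE cVH cΛ) (symTablesAn1S2 d Lc cΛ').M cE₂ cB T (symTablesAn1S2 d Lc cΛ').vh₂S
                (symTablesAn1S2 d Lc cΛ').mixFF j κ u κ' (translate (fine Lc M') u' n) x z a c)) b.2 (b.1 : Site (d + 1)) b'.2 (b'.1 : Site (d + 1)))
            + perF (fine Lc M') (mixOfK (GcombSh (d := d) Lc j) Lc
                (fun κ u ρ w => dper (fine Lc M') (fun x z a c => ∑' n : Site (d + 1), M2Of d Lc (symTablesAn1S2 d Lc cΛ').mixFF j κ u ρ (translate M' w n) x z a c))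
                b.2 (b.1 : Site (d + 1)) b'.2 (b'.1 : Site (d + 1)))
            + perF (fine Lc M') (mixOfK (GcombSh (d := d) Lc j) Lc
                (fun κ u ρ w => dper (fine Lc M') (fun x z a c => ∑' n : Site (d + 1), M2Of d Lc (symTablesAn1S2 d Lc cΛ').mixFF j κ u ρ (translate M' w n) x z a c))
                b'.2 (b'.1 : Site (d + 1)) b.2 (b.1 : Site (d + 1))))
          + (perF (fine Lc M') (vertex2OfK (GcombSh (d := d) Lc j) Lc (fun κ u κ' u' => dper (fine Lc M') (fun x z a c => ∑' n : Site (d + 1),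
              T2RecOf d Lc (GcombSh Lc) (SpureCombOf (symTablesAn1S2 d Lc cΛ') cE cVH cΛ) (symTablesAn1S2 d Lc cΛ').M cE₂ cB T (symTablesAn1S2 d Lc cΛ').vh₂S
                (symTablesAn1S2 d Lc cΛ').mixFF j κ u κ' (translate (fine Lc M') u' n) x z a c)) b'.2 (b'.1 : Site (d + 1)) b.2 (b.1 : Site (d + 1)))
            + perF (fine Lc M') (mixOfK (GcombSh (d := d) Lc j) Lc
                (fun κ u ρ w => dper (fine Lc M') (fun x z a c => ∑' n : Site (d + 1), M2Of d Lc (symTablesAn1S2 d Lc cΛ').mixFF j κ u ρ (translate M' w n) x z a c))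
                b'.2 (b'.1 : Site (d + 1)) b.2 (b.1 : Site (d + 1)))
            + perF (fine Lc M') (mixOfK (GcombSh (d := d) Lc j) Lc
                (fun κ u ρ w => dper (fine Lc M') (fun x z a c => ∑' n : Site (d + 1), M2Of d Lc (symTablesAn1S2 d Lc cΛ').mixFF j κ u ρ (translate M' w n) x z a c))
                b.2 (b.1 : Site (d + 1)) b'.2 (b'.1 : Site (d + 1))))))
    (b b' : ↥(pbox M') × Fin (d + 1)) : Ws b b' = Ws b' b := by
  subst hWs
  beta_reduce
  exact congrArg _ (add_comm _ _)

omit [∀ μ, NeZero (M' μ)] in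
/-- [folklore] the symmetrised response word is symmetric in the bond pair. -/
theorem Wz_swap (j : ℕ) {Wz : ↥(pbox M') × Fin (d + 1) → ↥(pbox M') × Fin (d + 1) → Matrix (Idx (fine Lc M') (Fib d)) (Idx (fine Lc M') (Fib d)) ℝ}
    (hWz : Wz = fun b b' => (1 / 2 : ℝ) •
        (perF (fine Lc M') (dM (K2OfK (GcombSh (d := d) Lc j) Lc (fun κ u => dper (fine Lc M') (SpureCombOf (symTablesAn1S2 d Lc cΛ') cE cVH cΛ j κ u))
              (fun ρ w => dper (fine Lc M') ((symTablesAn1S2 d Lc cΛ').M j ρ w)) b'.2 (b'.1 : Site (d + 1))) Lc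
            (fun κ u => dper (fine Lc M') (SpureCombOf (symTablesAn1S2 d Lc cΛ') cE cVH cΛ j κ u)) (fun ρ w => dper (fine Lc M') ((symTablesAn1S2 d Lc cΛ').M j ρ w))
            b.2 (b.1 : Site (d + 1)))
          + perF (fine Lc M') (dM (K2OfK (GcombSh (d := d) Lc j) Lc (fun κ u => dper (fine Lc M') (SpureCombOf (symTablesAn1S2 d Lc cΛ') cE cVH cΛ j κ u))
              (fun ρ w => dper (fine Lc M') ((symTablesAn1S2 d Lc cΛ').M j ρ w)) b.2 (b.1 : Site (d + 1))) Lc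
            (fun κ u => dper (fine Lc M') (SpureCombOf (symTablesAn1S2 d Lc cΛ') cE cVH cΛ j κ u)) (fun ρ w => dper (fine Lc M') ((symTablesAn1S2 d Lc cΛ').M j ρ w))
            b'.2 (b'.1 : Site (d + 1)))))
    (b b' : ↥(pbox M') × Fin (d + 1)) : Wz b b' = Wz b' b := by
  subst hWz
  beta_reduce
  exact congrArg _ (add_comm _ _)

/-- [folklore] a bond-pair symmetric family READ along `(w,v)` equals its READ along `(v,w)`. -/
theorem sum_sum_smul_swap {ι γ : Type*} [Fintype γ] (A : γ → γ → Matrix ι ι ℝ) (hA : ∀ b b', A b b' = A b' b) (v w : γ → ℝ) :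
    ∑ b, ∑ b', (w b * v b') • A b b' = ∑ b, ∑ b', (v b * w b') • A b b' := by
  rw [Finset.sum_comm]
  exact Finset.sum_congr rfl fun b _ => Finset.sum_congr rfl fun b' _ => by rw [hA b' b, mul_comm]

set_option synthInstance.maxSize 1024 in
set_option maxHeartbeats 800000 in
/-- **[folklore] `torus_thetaWord_record_an1_polar_sym` — THE SYMMETRISED POLARISED IDENTITY WITH ONE SET OF SECOND-ORDER JETS.**  As `torus_thetaWord_record_an1_polar`,
but the second-order jets are READ along `(v,w)` only (`H₂ Q₁₂ Hᶻ Qᶻ`): by `Ws_swap ∕ Wz_swap` the `(w,v)` READs coincide with them, so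
`(cE₂·wV4 (j+1)) · ((word(v,w) + word(w,v)) − 2 • R(v,w)) a₁ a₂ = Σ (v⊗w + w⊗v) · T2^{per}_{j+1}|ff (a₁, a₂)`, where `word(w,v)` carries the SAME `H₂ Q₁₂` as `word(v,w)` (only the first jets swap). -/
theorem torus_thetaWord_record_an1_polar_sym (j : ℕ)
    {Θ : Matrix (↥(pbox (fine Lc M')) × Fin (d + 1)) (↥(pbox M') × Fin (d + 1)) ℝ}
    {ΘL : Matrix (↥(pbox M') × Fin (d + 1)) (↥(pbox (fine Lc M')) × Fin (d + 1)) ℝ} {Ŝ : Matrix (↥(pbox M') × Fin (d + 1)) (↥(pbox M') × Fin (d + 1)) ℝ}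
    {Γc : Matrix (↥(pbox (fine Lc M')) × Fin (d + 1)) (↥(pbox (fine Lc M')) × Fin (d + 1)) ℝ}
    (hΘ : Θ = Matrix.of fun (b : ↥(pbox (fine Lc M')) × Fin (d + 1)) (a : ↥(pbox M') × Fin (d + 1)) =>
        axEc (ctr (d + 1) Lc) Lc (b.1 : Site (d + 1)) (b.1 : Site (d + 1)) (Sum.inl b.2) (Sum.inl b.2)
          * perF (fine Lc M') (GcombSh (d := d) Lc j) (b.1, Sum.inl b.2) (coarsePt M' Lc a.1, Sum.inr a.2))
    (hΘL : ΘL = Matrix.of fun (a : ↥(pbox M') × Fin (d + 1)) (b : ↥(pbox (fine Lc M')) × Fin (d + 1)) =>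
        axEc (ctr (d + 1) Lc) Lc (b.1 : Site (d + 1)) (b.1 : Site (d + 1)) (Sum.inl b.2) (Sum.inl b.2)
          * perF (fine Lc M') (GcombSh (d := d) Lc j) (coarsePt M' Lc a.1, Sum.inr a.2) (b.1, Sum.inl b.2))
    (hŜ : Ŝ = (perF (fine Lc M') (GcombSh (d := d) Lc j)).submatrix
        (fun a : ↥(pbox M') × Fin (d + 1) => ((coarsePt M' Lc a.1, Sum.inr a.2) : Idx (fine Lc M') (Fib d)))
        (fun a : ↥(pbox M') × Fin (d + 1) => ((coarsePt M' Lc a.1, Sum.inr a.2) : Idx (fine Lc M') (Fib d))))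
    (hΓc : Γc = Matrix.of fun (b b' : ↥(pbox (fine Lc M')) × Fin (d + 1)) =>
        axEc (ctr (d + 1) Lc) Lc (b.1 : Site (d + 1)) (b.1 : Site (d + 1)) (Sum.inl b.2) (Sum.inl b.2)
          * (axEc (ctr (d + 1) Lc) Lc (b'.1 : Site (d + 1)) (b'.1 : Site (d + 1)) (Sum.inl b'.2) (Sum.inl b'.2)
            * perF (fine Lc M') (GcombSh (d := d) Lc j) (b.1, Sum.inl b.2) (b'.1, Sum.inl b'.2)))
    {Dh : ↥(pbox M') × Fin (d + 1) → Matrix (Idx (fine Lc M') (Fib d)) (Idx (fine Lc M') (Fib d)) ℝ}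
    (hDh : Dh = fun b => perF (fine Lc M') (dM (GcombSh (d := d) Lc j) Lc (fun κ u => dper (fine Lc M') (SpureCombOf (symTablesAn1S2 d Lc cΛ') cE cVH cΛ j κ u))
        (fun ρ w => dper (fine Lc M') ((symTablesAn1S2 d Lc cΛ').M j ρ w)) b.2 (b.1 : Site (d + 1))))
    {Ws Wz : ↥(pbox M') × Fin (d + 1) → ↥(pbox M') × Fin (d + 1) → Matrix (Idx (fine Lc M') (Fib d)) (Idx (fine Lc M') (Fib d)) ℝ}
    (hWs : Ws = fun b b' => (1 / 2 : ℝ) •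
        ((perF (fine Lc M') (vertex2OfK (GcombSh (d := d) Lc j) Lc (fun κ u κ' u' => dper (fine Lc M') (fun x z a c => ∑' n : Site (d + 1),
              T2RecOf d Lc (GcombSh Lc) (SpureCombOf (symTablesAn1S2 d Lc cΛ') cE cVH cΛ) (symTablesAn1S2 d Lc cΛ').M cE₂ cB T (symTablesAn1S2 d Lc cΛ').vh₂S
                (symTablesAn1S2 d Lc cΛ').mixFF j κ u κ' (translate (fine Lc M') u' n) x z a c)) b.2 (b.1 : Site (d + 1)) b'.2 (b'.1 : Site (d + 1)))
            + perF (fine Lc M') (mixOfK (GcombSh (d := d) Lc j) Lc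
                (fun κ u ρ w => dper (fine Lc M') (fun x z a c => ∑' n : Site (d + 1), M2Of d Lc (symTablesAn1S2 d Lc cΛ').mixFF j κ u ρ (translate M' w n) x z a c))
                b.2 (b.1 : Site (d + 1)) b'.2 (b'.1 : Site (d + 1)))
            + perF (fine Lc M') (mixOfK (GcombSh (d := d) Lc j) Lc
                (fun κ u ρ w => dper (fine Lc M') (fun x z a c => ∑' n : Site (d + 1), M2Of d Lc (symTablesAn1S2 d Lc cΛ').mixFF j κ u ρ (translate M' w n) x z a c))
                b'.2 (b'.1 : Site (d + 1)) b.2 (b.1 : Site (d + 1))))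
          + (perF (fine Lc M') (vertex2OfK (GcombSh (d := d) Lc j) Lc (fun κ u κ' u' => dper (fine Lc M') (fun x z a c => ∑' n : Site (d + 1),
              T2RecOf d Lc (GcombSh Lc) (SpureCombOf (symTablesAn1S2 d Lc cΛ') cE cVH cΛ) (symTablesAn1S2 d Lc cΛ').M cE₂ cB T (symTablesAn1S2 d Lc cΛ').vh₂S
                (symTablesAn1S2 d Lc cΛ').mixFF j κ u κ' (translate (fine Lc M') u' n) x z a c)) b'.2 (b'.1 : Site (d + 1)) b.2 (b.1 : Site (d + 1)))
            + perF (fine Lc M') (mixOfK (GcombSh (d := d) Lc j) Lc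
                (fun κ u ρ w => dper (fine Lc M') (fun x z a c => ∑' n : Site (d + 1), M2Of d Lc (symTablesAn1S2 d Lc cΛ').mixFF j κ u ρ (translate M' w n) x z a c))
                b'.2 (b'.1 : Site (d + 1)) b.2 (b.1 : Site (d + 1)))
            + perF (fine Lc M') (mixOfK (GcombSh (d := d) Lc j) Lc
                (fun κ u ρ w => dper (fine Lc M') (fun x z a c => ∑' n : Site (d + 1), M2Of d Lc (symTablesAn1S2 d Lc cΛ').mixFF j κ u ρ (translate M' w n) x z a c))
                b.2 (b.1 : Site (d + 1)) b'.2 (b'.1 : Site (d + 1))))))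
    (hWz : Wz = fun b b' => (1 / 2 : ℝ) •
        (perF (fine Lc M') (dM (K2OfK (GcombSh (d := d) Lc j) Lc (fun κ u => dper (fine Lc M') (SpureCombOf (symTablesAn1S2 d Lc cΛ') cE cVH cΛ j κ u))
              (fun ρ w => dper (fine Lc M') ((symTablesAn1S2 d Lc cΛ').M j ρ w)) b'.2 (b'.1 : Site (d + 1))) Lc
            (fun κ u => dper (fine Lc M') (SpureCombOf (symTablesAn1S2 d Lc cΛ') cE cVH cΛ j κ u)) (fun ρ w => dper (fine Lc M') ((symTablesAn1S2 d Lc cΛ').M j ρ w))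
            b.2 (b.1 : Site (d + 1)))
          + perF (fine Lc M') (dM (K2OfK (GcombSh (d := d) Lc j) Lc (fun κ u => dper (fine Lc M') (SpureCombOf (symTablesAn1S2 d Lc cΛ') cE cVH cΛ j κ u))
              (fun ρ w => dper (fine Lc M') ((symTablesAn1S2 d Lc cΛ').M j ρ w)) b.2 (b.1 : Site (d + 1))) Lc
            (fun κ u => dper (fine Lc M') (SpureCombOf (symTablesAn1S2 d Lc cΛ') cE cVH cΛ j κ u)) (fun ρ w => dper (fine Lc M') ((symTablesAn1S2 d Lc cΛ').M j ρ w))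
            b'.2 (b'.1 : Site (d + 1)))))
    (v w : ↥(pbox M') × Fin (d + 1) → ℝ)
    {H₁ H₁' H₂ Hz : Matrix (↥(pbox (fine Lc M')) × Fin (d + 1)) (↥(pbox (fine Lc M')) × Fin (d + 1)) ℝ}
    {Q₁₁ Q₁₁' Q₁₂ Qz : Matrix (↥(pbox M') × Fin (d + 1)) (↥(pbox (fine Lc M')) × Fin (d + 1)) ℝ}
    (hH₁ : H₁ = (∑ b, v b • Dh b).submatrix (fun b : ↥(pbox (fine Lc M')) × Fin (d + 1) => ((b.1, Sum.inl b.2) : Idx (fine Lc M') (Fib d)))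
        (fun b : ↥(pbox (fine Lc M')) × Fin (d + 1) => ((b.1, Sum.inl b.2) : Idx (fine Lc M') (Fib d))))
    (hQ₁₁ : Q₁₁ = (∑ b, v b • Dh b).submatrix (fun a : ↥(pbox M') × Fin (d + 1) => ((coarsePt M' Lc a.1, Sum.inr a.2) : Idx (fine Lc M') (Fib d)))
        (fun b : ↥(pbox (fine Lc M')) × Fin (d + 1) => ((b.1, Sum.inl b.2) : Idx (fine Lc M') (Fib d))))
    (hH₁' : H₁' = (∑ b, w b • Dh b).submatrix (fun b : ↥(pbox (fine Lc M')) × Fin (d + 1) => ((b.1, Sum.inl b.2) : Idx (fine Lc M') (Fib d)))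
        (fun b : ↥(pbox (fine Lc M')) × Fin (d + 1) => ((b.1, Sum.inl b.2) : Idx (fine Lc M') (Fib d))))
    (hQ₁₁' : Q₁₁' = (∑ b, w b • Dh b).submatrix (fun a : ↥(pbox M') × Fin (d + 1) => ((coarsePt M' Lc a.1, Sum.inr a.2) : Idx (fine Lc M') (Fib d)))
        (fun b : ↥(pbox (fine Lc M')) × Fin (d + 1) => ((b.1, Sum.inl b.2) : Idx (fine Lc M') (Fib d))))
    (hH₂ : H₂ = (∑ b, ∑ b', (v b * w b') • Ws b b').submatrix (fun b : ↥(pbox (fine Lc M')) × Fin (d + 1) => ((b.1, Sum.inl b.2) : Idx (fine Lc M') (Fib d)))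
        (fun b : ↥(pbox (fine Lc M')) × Fin (d + 1) => ((b.1, Sum.inl b.2) : Idx (fine Lc M') (Fib d))))
    (hQ₁₂ : Q₁₂ = (∑ b, ∑ b', (v b * w b') • Ws b b').submatrix (fun a : ↥(pbox M') × Fin (d + 1) => ((coarsePt M' Lc a.1, Sum.inr a.2) : Idx (fine Lc M') (Fib d)))
        (fun b : ↥(pbox (fine Lc M')) × Fin (d + 1) => ((b.1, Sum.inl b.2) : Idx (fine Lc M') (Fib d))))
    (hHz : Hz = (∑ b, ∑ b', (v b * w b') • Wz b b').submatrix (fun b : ↥(pbox (fine Lc M')) × Fin (d + 1) => ((b.1, Sum.inl b.2) : Idx (fine Lc M') (Fib d)))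
        (fun b : ↥(pbox (fine Lc M')) × Fin (d + 1) => ((b.1, Sum.inl b.2) : Idx (fine Lc M') (Fib d))))
    (hQz : Qz = (∑ b, ∑ b', (v b * w b') • Wz b b').submatrix (fun a : ↥(pbox M') × Fin (d + 1) => ((coarsePt M' Lc a.1, Sum.inr a.2) : Idx (fine Lc M') (Fib d)))
        (fun b : ↥(pbox (fine Lc M')) × Fin (d + 1) => ((b.1, Sum.inl b.2) : Idx (fine Lc M') (Fib d))))
    (a₁ a₂ : ↥(pbox M') × Fin (d + 1)) :
    (cE₂ * wV4 d Lc (j + 1)) *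
      ((((((-((-ΘL * H₁ - Ŝ * Q₁₁) * Γc - -ΘL * Q₁₁ᵀ * -ΘL) * H₁' + -ΘL * H₂
          - (((-ΘL * H₁ - Ŝ * Q₁₁) * Θ + -ΘL * Q₁₁ᵀ * Ŝ) * Q₁₁' + Ŝ * Q₁₂)) * Θ
        + (-ΘL * H₁ - Ŝ * Q₁₁) * (-((Γc * H₁' + Θ * Q₁₁') * Θ + Γc * Q₁₁'ᵀ * Ŝ)))
      - ((-((-ΘL * H₁ - Ŝ * Q₁₁) * Γc - -ΘL * Q₁₁ᵀ * -ΘL) * (-Q₁₁'ᵀ) + -ΘL * Q₁₂ᵀ) * Ŝ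
          + -ΘL * (-Q₁₁ᵀ) * ((-ΘL * H₁' - Ŝ * Q₁₁') * Θ + -ΘL * Q₁₁'ᵀ * Ŝ))))
        + ((((-((-ΘL * H₁' - Ŝ * Q₁₁') * Γc - -ΘL * Q₁₁'ᵀ * -ΘL) * H₁ + -ΘL * H₂
          - (((-ΘL * H₁' - Ŝ * Q₁₁') * Θ + -ΘL * Q₁₁'ᵀ * Ŝ) * Q₁₁ + Ŝ * Q₁₂)) * Θ
        + (-ΘL * H₁' - Ŝ * Q₁₁') * (-((Γc * H₁ + Θ * Q₁₁) * Θ + Γc * Q₁₁ᵀ * Ŝ)))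
      - ((-((-ΘL * H₁' - Ŝ * Q₁₁') * Γc - -ΘL * Q₁₁'ᵀ * -ΘL) * (-Q₁₁ᵀ) + -ΘL * Q₁₂ᵀ) * Ŝ
          + -ΘL * (-Q₁₁'ᵀ) * ((-ΘL * H₁ - Ŝ * Q₁₁) * Θ + -ΘL * Q₁₁ᵀ * Ŝ)))))
        - (2 : ℝ) • (ΘL * Hz * Θ + ΘL * Qzᵀ * Ŝ + Ŝ * Qz * Θ)) a₁ a₂
      = ∑ b : ↥(pbox M') × Fin (d + 1), ∑ b' : ↥(pbox M') × Fin (d + 1), (v b * w b' + w b * v b')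
          * perF M' (dper M' (fun x z a c => ∑' n, T2RecOf d Lc (GcombSh Lc) (SpureCombOf (symTablesAn1S2 d Lc cΛ') cE cVH cΛ) (symTablesAn1S2 d Lc cΛ').M cE₂ cB T
              (symTablesAn1S2 d Lc cΛ').vh₂S (symTablesAn1S2 d Lc cΛ').mixFF (j + 1)
              b.2 (b.1 : Site (d + 1)) b'.2 (translate M' (b'.1 : Site (d + 1)) n) x z a c)) (a₁.1, Sum.inl a₁.2) (a₂.1, Sum.inl a₂.2) := by
  have hsW := sum_sum_smul_swap Ws (Ws_swap M' cΛ' cE cVH cΛ cE₂ cB T j hWs) v w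
  have hsZ := sum_sum_smul_swap Wz (Wz_swap M' cΛ' cE cVH cΛ j hWz) v w
  have h := torus_thetaWord_record_an1_polar M' cΛ' cE cVH cΛ cE₂ cB T j hΘ hΘL hŜ hΓc hDh hWs hWz v w hH₁ hQ₁₁ hH₂ hQ₁₂ hHz hQz
    hH₁' hQ₁₁' (hH₂.trans (by rw [hsW])) (hQ₁₂.trans (by rw [hsW])) (hHz.trans (by rw [hsZ])) (hQz.trans (by rw [hsZ])) a₁ a₂
  rw [← two_smul ℝ (ΘL * Hz * Θ + ΘL * Qzᵀ * Ŝ + Ŝ * Qz * Θ)] at h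
  exact h

end Swap

end Summit.QuantumFields.BalabanUV.Beta.FP.CoarseJetOrderTwoGradedCombJunctionRecordAn1Polar

end
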